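import Literature.Probability.RandomPlanarGeometry.RadialBesselRenewal
import Literature.Probability.Percolation.OneArmComparisonExplicit
import Literature.Probability.Percolation.OneArmSubsequentialLimits
import HarnessLib

/-!
# The one-arm exponent: exponential two-sided bounds from the diffusion (LSW Thm. 1.2 via renewal)

Topic `Probability/Percolation`; theorems and three auxiliary definitions. LSW (2002) prove
Theorem 1.2 (`h(θ, t) ≍ e^{-λt} H(θ)`) by applying the maximum principle (2.17) to the time
average `h̃` of the hitting function `h`, whose regularity (Lemma 2.2) is quoted from "the theory of
diffusion processes". Here the comparison is applied instead to the **renewal extension**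
`g = renewalST κ V U` (`RadialBesselRenewal`) of twice time-averaged boundary data
`U = avg(avg u)`, `V = avg(avg 1_{(-∞,0]})` (`avg = tildeAvg`, LSW's `h̃`-average), whose
regularity and PDE were PROVED from the radial Bessel SDE (`RadialBesselHarmonic`,
`RadialBesselBoundary`, `RadialBesselRenewal`):

* `hasDerivAt_tildeAvg_of_continuous` — `avg f ∈ C¹` with `(avg f)' = f(· + 1) - f` for continuous `f`;
* `dataU`, `dataV` and their properties (`C¹`, values in `[0, 1]`, `u(t + 2) ≤ U(t) ≤ u(t)`,
  `V = 0` on `[0, ∞)`);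
* `LawlerSchrammWerner2002_exp_bounds_of_neumann` — **THEOREM A**: for `κ > 4`, an antitone
  `u : ℝ → [0, 1]` with `u = 1` on `(-∞, 0]` and `u(3) ≥ m₀ > 0`, IF the renewal extension is
  Neumann-flat at `2π` (LSW's reflection condition, the one remaining analytic input), then
  `e^{-λt}/c₂ ≤ u(t)` (`t ≥ 1`) and `u(t) ≤ c₁ e^{2λ} e^{-λt}` (`t ≥ 3`) with `c₁ = c₁(κ)` and
  `c₂ = c₂(κ, m₀)` EXPLICIT (`OneArmComparisonExplicit`), the lower bounds on the three segments
  coming from `g ≥ u(t + 2) P^θ[Y_T = 2π]` and the scale-function formula for `P^θ[Y_T = 2π]`.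

## References

* G. F. Lawler, O. Schramm, W. Werner, *One-arm exponent for critical 2D percolation*, Electron.
  J. Probab. 7 (2002), no. 2, Thm. 1.2, §2 (Lemma 2.2, (2.10), (2.17)). [LawlerSchrammWernerEJP2002]
-/

noncomputable section

open MeasureTheory Filter Topology Set
open scoped NNReal

namespace Literature.Probability.Percolation

open Literature.Probability.RandomPlanarGeometry.RadialLoewner Literature.Analysis.FunctionSpaces
open Literature.Probability.Process Literature.Probability.RandomPlanarGeometry

/-! ### Time averages of continuous functions are `C¹` -/

/-- **`(avg f)'(t) = f(t + 1) - f(t)`** for continuous `f` (`avg f (t) = ∫_t^{t+1} f`). [folklore] -/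
theorem hasDerivAt_tildeAvg_of_continuous {f : ℝ → ℝ} (hf : Continuous f) (t : ℝ) :
    HasDerivAt (tildeAvg f) (f (t + 1) - f t) t := by
  have heq : tildeAvg f = fun t ↦ (∫ s in (0 : ℝ)..t + 1, f s) - ∫ s in (0 : ℝ)..t, f s := by
    funext t
    rw [tildeAvg_eq_integral, intervalIntegral.integral_interval_sub_left (hf.intervalIntegrable _ _)
      (hf.intervalIntegrable _ _)]
  rw [heq]
  have h1 := ((hf.integral_hasStrictDerivAt 0 (t + 1)).hasDerivAt.comp t ((hasDerivAt_id t).add_const 1))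
  have h2 := (hf.integral_hasStrictDerivAt 0 t).hasDerivAt
  have h3 : HasDerivAt (fun t ↦ (∫ s in (0 : ℝ)..t + 1, f s) - ∫ s in (0 : ℝ)..t, f s) (f (id t + 1) * 1 - f t) t :=
    h1.sub h2
  exact h3.congr_deriv (by simp)

/-! ### Twice-averaged antitone data -/

section Data

variable {u : ℝ → ℝ} (hu : Antitone u) (hb : ∀ s, u s ∈ Icc (0 : ℝ) 1)
include hu hb

/-- `avg u` is continuous (`1`-Lipschitz) for antitone `u ∈ [0, 1]`. [folklore] -/
theorem continuous_tildeAvg_of_antitone : Continuous (tildeAvg u) := by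
  refine continuous_iff_continuousAt.2 fun t ↦ Metric.continuousAt_iff.2 fun ε hε ↦ ⟨ε, hε, fun {t'} ht' ↦ ?_⟩
  rw [Real.dist_eq] at ht' ⊢
  exact lt_of_le_of_lt (abs_tildeAvg_sub_le hu hb t' t) ht'

/-- `avg u ∈ [0, 1]`. [folklore] -/
theorem tildeAvg_mem_Icc_of_antitone (t : ℝ) : tildeAvg u t ∈ Icc (0 : ℝ) 1 :=
  ⟨tildeAvg_nonneg (fun s ↦ (hb s).1) t, tildeAvg_le_one hu (fun s ↦ (hb s).2) t⟩

/-- **`U = avg (avg u)` is `C¹`** with `U'(t) = avg u (t + 1) - avg u (t)`. [folklore] -/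
theorem hasDerivAt_tildeAvg_tildeAvg (t : ℝ) :
    HasDerivAt (tildeAvg (tildeAvg u)) (tildeAvg u (t + 1) - tildeAvg u t) t :=
  hasDerivAt_tildeAvg_of_continuous (continuous_tildeAvg_of_antitone hu hb) t

/-- `U' = avg u (· + 1) - avg u` is continuous. [folklore] -/
theorem continuous_tildeAvg_shift_sub : Continuous fun t ↦ tildeAvg u (t + 1) - tildeAvg u t :=
  ((continuous_tildeAvg_of_antitone hu hb).comp (continuous_id.add continuous_const)).sub
    (continuous_tildeAvg_of_antitone hu hb)

/-- `|U'| ≤ 1`. [folklore] -/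
theorem abs_tildeAvg_shift_sub_le (t : ℝ) : |tildeAvg u (t + 1) - tildeAvg u t| ≤ 1 := by
  have h1 := tildeAvg_mem_Icc_of_antitone hu hb (t + 1)
  have h2 := tildeAvg_mem_Icc_of_antitone hu hb t
  rw [abs_le]; constructor <;> linarith [h1.1, h1.2, h2.1, h2.2]

/-- `U = avg (avg u) ∈ [0, 1]`. [folklore] -/
theorem tildeAvg_tildeAvg_mem_Icc (t : ℝ) : tildeAvg (tildeAvg u) t ∈ Icc (0 : ℝ) 1 :=
  tildeAvg_mem_Icc_of_antitone (tildeAvg_antitone hu) (tildeAvg_mem_Icc_of_antitone hu hb) t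

/-- `|U| ≤ 1`. [folklore] -/
theorem abs_tildeAvg_tildeAvg_le (t : ℝ) : |tildeAvg (tildeAvg u) t| ≤ 1 := by
  have h := tildeAvg_tildeAvg_mem_Icc hu hb t
  rw [abs_of_nonneg h.1]; exact h.2

omit hb in
/-- **The sandwich `u(t + 2) ≤ U(t) ≤ u(t)`.** [folklore] -/
theorem tildeAvg_tildeAvg_le (t : ℝ) : tildeAvg (tildeAvg u) t ≤ u t :=
  (tildeAvg_le (tildeAvg_antitone hu) t).trans (tildeAvg_le hu t)

omit hb in
/-- **The sandwich `u(t + 2) ≤ U(t) ≤ u(t)`** (lower half). [folklore] -/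
theorem le_tildeAvg_tildeAvg (t : ℝ) : u (t + 2) ≤ tildeAvg (tildeAvg u) t := by
  have h1 := le_tildeAvg (tildeAvg_antitone hu) t
  have h2 := le_tildeAvg hu (t + 1)
  rw [show t + 1 + 1 = t + 2 by ring] at h2
  exact h2.trans h1

end Data

/-- **The bottom datum** `v₀ = 1_{(-∞, 0]}` (LSW: `h(θ, t) = 1` for `t ≤ 0`, `h(0, t) = 0` for
`t > 0`). [cite: LawlerSchrammWernerEJP2002, §2 (2.3)] -/
def bottomDatum (t : ℝ) : ℝ := if t ≤ 0 then 1 else 0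

/-- `v₀` is antitone. [folklore] -/
theorem antitone_bottomDatum : Antitone bottomDatum := by
  intro a b hab
  unfold bottomDatum
  by_cases hb : b ≤ 0
  · rw [if_pos hb, if_pos (hab.trans hb)]
  · rw [if_neg hb]; split_ifs <;> norm_num

/-- `v₀ ∈ [0, 1]`. [folklore] -/
theorem bottomDatum_mem_Icc (t : ℝ) : bottomDatum t ∈ Icc (0 : ℝ) 1 := by
  unfold bottomDatum; split_ifs <;> norm_num

/-- **The smoothed bottom datum `V = avg (avg v₀)`.** [folklore] -/
def dataV : ℝ → ℝ := tildeAvg (tildeAvg bottomDatum)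

/-- **The smoothed top datum `U = avg (avg u)`.** [folklore] -/
def dataU (u : ℝ → ℝ) : ℝ → ℝ := tildeAvg (tildeAvg u)

/-- `avg v₀ (t) = 0` for `t ≥ 0`. [folklore] -/
theorem tildeAvg_bottomDatum_eq_zero {t : ℝ} (ht : 0 ≤ t) : tildeAvg bottomDatum t = 0 := by
  rw [tildeAvg, intervalIntegral.integral_of_le zero_le_one]
  refine (setIntegral_congr_fun measurableSet_Ioc fun s hs ↦ ?_).trans (integral_zero _ _)
  · show bottomDatum (t + s) = (fun _ ↦ (0 : ℝ)) s
    rw [bottomDatum, if_neg (by linarith [hs.1])]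

/-- **`V(t) = 0` for `t ≥ 0`.** [folklore] -/
theorem dataV_eq_zero {t : ℝ} (ht : 0 ≤ t) : dataV t = 0 := by
  rw [dataV, tildeAvg, intervalIntegral.integral_of_le zero_le_one]
  refine (setIntegral_congr_fun measurableSet_Ioc fun s hs ↦ ?_).trans (integral_zero _ _)
  · show tildeAvg bottomDatum (t + s) = (fun _ ↦ (0 : ℝ)) s
    exact tildeAvg_bottomDatum_eq_zero (by linarith [hs.1])

/-- **`V(t) = 1` for `t ≤ -2`.** [folklore] -/
theorem dataV_eq_one {t : ℝ} (ht : t ≤ -2) : dataV t = 1 := by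
  have h1 := le_tildeAvg_tildeAvg antitone_bottomDatum t
  have h2 := (tildeAvg_tildeAvg_mem_Icc antitone_bottomDatum bottomDatum_mem_Icc t).2
  have h3 : bottomDatum (t + 2) = 1 := by rw [bottomDatum, if_pos (by linarith)]
  rw [dataV]
  rw [h3] at h1
  exact le_antisymm h2 h1

/-! ### Theorem A: exponential bounds from the comparison, given Neumann flatness -/

/-- `P^θ[Y_T = 2π] ≥ P^1[Y_T = 2π]` for `θ ∈ [1, 2π)` (the scale-function formula is monotone).
[folklore] -/
theorem measureReal_sleExitsTop_one_le {κ : ℝ≥0} (hκ : 4 < κ) {θ : ℝ} (h1 : 1 ≤ θ) (h2 : θ < 2 * Real.pi) :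
    preWienerMeasure.real (sleExitsTop κ 1) ≤ preWienerMeasure.real (sleExitsTop κ θ) := by
  have hπ := Real.pi_gt_three
  have h1m : (1 : ℝ) ∈ Ioo 0 (2 * Real.pi) := ⟨one_pos, by linarith⟩
  have hθm : θ ∈ Ioo 0 (2 * Real.pi) := ⟨by linarith, h2⟩
  rw [measureReal_sleExitsTop_eq hκ h1m, measureReal_sleExitsTop_eq hκ hθm]
  have hmono := (strictMonoOn_sleScale hκ).monotoneOn
  have hD : 0 < sleScale κ (2 * Real.pi) - sleScale κ 0 :=
    sub_pos.2 (strictMonoOn_sleScale hκ ⟨le_rfl, by linarith⟩ ⟨by linarith, le_rfl⟩ (by linarith))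
  exact div_le_div_of_nonneg_right (sub_le_sub_right
    (hmono ⟨zero_le_one, by linarith⟩ ⟨by linarith, h2.le⟩ h1) _) hD.le

/-- `P^1[Y_T = 2π] > 0`. [folklore] -/
theorem measureReal_sleExitsTop_one_pos {κ : ℝ≥0} (hκ : 4 < κ) : 0 < preWienerMeasure.real (sleExitsTop κ 1) := by
  have hπ := Real.pi_gt_three
  have h1m : (1 : ℝ) ∈ Ioo 0 (2 * Real.pi) := ⟨one_pos, by linarith⟩
  rw [measureReal_sleExitsTop_eq hκ h1m]
  have hD : 0 < sleScale κ (2 * Real.pi) - sleScale κ 0 :=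
    sub_pos.2 (strictMonoOn_sleScale hκ ⟨le_rfl, by linarith⟩ ⟨by linarith, le_rfl⟩ (by linarith))
  have hN : 0 < sleScale κ 1 - sleScale κ 0 :=
    sub_pos.2 (strictMonoOn_sleScale hκ ⟨le_rfl, by linarith⟩ ⟨zero_le_one, by linarith⟩ one_pos)
  exact div_pos hN hD

section TheoremA

variable {κ : ℝ≥0} (hκ : 4 < κ) {u : ℝ → ℝ} (hu : Antitone u) (hb : ∀ s, u s ∈ Icc (0 : ℝ) 1)
include hκ hu hb

/-- **Lower bound of the renewal extension on `[1, 2π) × (-∞, 1]`**: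
`g(θ, t) ≥ u(3) P^1[Y_T = 2π]` (`U(t - T) ≥ u(t - T + 2) ≥ u(3)`, `V ≥ 0`). [folklore] -/
theorem renewalST_lower {θ t : ℝ} (h1 : 1 ≤ θ) (h2 : θ < 2 * Real.pi) (ht : t ≤ 1) :
    u 3 * preWienerMeasure.real (sleExitsTop κ 1) ≤ renewalST κ dataV (dataU u) θ t := by
  haveI := isProbabilityMeasure_preWienerMeasure'
  have hπ := Real.pi_gt_three
  have hθ : θ ∈ Ioo 0 (2 * Real.pi) := ⟨by linarith, h2⟩
  rw [renewalST_of_mem κ _ _ hθ]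
  have hu3 : 0 ≤ u 3 := (hb 3).1
  -- the bottom part is nonnegative
  have hbot : 0 ≤ botST κ dataV θ t := by
    unfold botST botExpect
    refine integral_nonneg fun ω ↦ ?_
    by_cases hω : ω ∈ sleExitsBot κ θ
    · simp only [indicator_of_mem hω]
      exact (tildeAvg_tildeAvg_mem_Icc antitone_bottomDatum bottomDatum_mem_Icc _).1
    · simp only [indicator_of_notMem hω]; exact le_rfl
  -- the top part is at least `u(3) P^θ[top]`
  have hUc : Continuous (dataU u) := continuous_iff_continuousAt.2 fun s ↦
    (hasDerivAt_tildeAvg_tildeAvg hu hb s).continuousAt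
  have hmT := measurable_sleLifetimeReal κ θ
  have htop : u 3 * preWienerMeasure.real (sleExitsTop κ θ) ≤ topST κ (dataU u) θ t := by
    unfold topST topExpect
    have hi : Integrable (fun ω ↦ (sleExitsTop κ θ).indicator
        (fun ω ↦ dataU u (t - sleLifetimeReal κ θ ω)) ω) preWienerMeasure :=
      integrable_of_abs_le ((hUc.measurable.comp (measurable_const.sub hmT)).indicator
        (measurableSet_sleExitsTop κ θ)) (C := 1) fun ω ↦ by
        by_cases hω : ω ∈ sleExitsTop κ θ
        · simp only [indicator_of_mem hω]; exact abs_tildeAvg_tildeAvg_le hu hb _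
        · simp only [indicator_of_notMem hω, abs_zero]; exact zero_le_one
    calc u 3 * preWienerMeasure.real (sleExitsTop κ θ)
        = ∫ ω, (sleExitsTop κ θ).indicator (fun _ ↦ u 3) ω ∂preWienerMeasure := by
          rw [integral_indicator_const _ (measurableSet_sleExitsTop κ θ), smul_eq_mul, mul_comm]
      _ ≤ _ := by
          refine integral_mono ((integrable_const _).indicator (measurableSet_sleExitsTop κ θ)) hi fun ω ↦ ?_
          by_cases hω : ω ∈ sleExitsTop κ θ
          · simp only [indicator_of_mem hω]
            have hT := sleLifetimeReal_nonneg κ θ ω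
            calc u 3 ≤ u (t - sleLifetimeReal κ θ ω + 2) := hu (by linarith)
              _ ≤ dataU u (t - sleLifetimeReal κ θ ω) := le_tildeAvg_tildeAvg hu _
          · simp only [indicator_of_notMem hω]; exact le_rfl
  have hp := measureReal_sleExitsTop_one_le hκ h1 h2
  linarith [mul_le_mul_of_nonneg_left hp hu3]

/-- **THEOREM A (LSW's Thm. 1.2 at `θ = 2π`, from the diffusion, given Neumann flatness).** Let
`κ > 4`, `u : ℝ → [0, 1]` antitone with `u(3) ≥ m₀ > 0`, and suppose the renewal extension
`g = renewalST κ V U` of the twice-averaged data `U = avg(avg u)`, `V = avg(avg 1_{(-∞,0]})`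
satisfies LSW's Neumann condition `∂_θ g(2π, t) = 0` (`t > 0`). Then, with `λ = lswLambda κ`,
`p₁ = P^1[Y_T = 2π]`, `c₂ = ((1 + π²) + π² + 1)/(m₀ p₁)` and `c₁ = c₁(κ)` of
`LawlerSchrammWerner2002_comparison_explicit`:
`e^{-λt}/c₂ ≤ u(t)` for `t ≥ 1` and `u(t) ≤ c₁ e^{-λ(t-2)}` for `t ≥ 3`. All other hypotheses of
the comparison (continuity on the closed strip, `C^{2,1}` regularity, the PDE (2.4), Dirichlet data,
bounds, interior lower bounds) are supplied by the radial Bessel process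
(`RadialBesselRenewal`). [cite: LawlerSchrammWernerEJP2002, Thm. 1.2 and its proof (p. 8)] -/
theorem LawlerSchrammWerner2002_exp_bounds_of_neumann {m₀ : ℝ} (hm₀ : 0 < m₀) (hm : m₀ ≤ u 3)
    (hneu : ∀ t, 0 < t →
      HasDerivWithinAt (fun x ↦ renewalST κ dataV (dataU u) x t) 0 (Iic (2 * Real.pi)) (2 * Real.pi)) :
    (∀ t, 1 ≤ t → Real.exp (-(lswLambda κ * t)) /
        ((1 + Real.pi ^ 2) / (m₀ * preWienerMeasure.real (sleExitsTop κ 1)) +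
          Real.pi ^ 2 / (m₀ * preWienerMeasure.real (sleExitsTop κ 1)) +
          1 / (m₀ * preWienerMeasure.real (sleExitsTop κ 1))) ≤ u t) ∧
    (∀ t, 3 ≤ t → u t ≤ ((1 + Real.pi ^ 2) / (Real.sin (Real.pi / 4) ^ lswQ κ * Real.exp (-(lswLambda κ * 1))) +
        Real.pi ^ 2 / (Real.sin (1 / 4) ^ lswQ κ * Real.exp (-(lswLambda κ * 0)))) *
        Real.exp (-(lswLambda κ * (t - 2)))) := by
  have hπ := Real.pi_gt_three
  have hκ' : (4 : ℝ) < κ := by exact_mod_cast hκ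
  -- the data
  set V := dataV with hVdef
  set U := dataU u with hUdef
  set V' : ℝ → ℝ := fun t ↦ tildeAvg bottomDatum (t + 1) - tildeAvg bottomDatum t with hV'def
  set U' : ℝ → ℝ := fun t ↦ tildeAvg u (t + 1) - tildeAvg u t with hU'def
  have hV : ∀ s, HasDerivAt V (V' s) s := hasDerivAt_tildeAvg_tildeAvg antitone_bottomDatum bottomDatum_mem_Icc
  have hU : ∀ s, HasDerivAt U (U' s) s := hasDerivAt_tildeAvg_tildeAvg hu hb
  have hV'c : Continuous V' := continuous_tildeAvg_shift_sub antitone_bottomDatum bottomDatum_mem_Icc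
  have hU'c : Continuous U' := continuous_tildeAvg_shift_sub hu hb
  have hVb : ∀ s, |V s| ≤ 1 := abs_tildeAvg_tildeAvg_le antitone_bottomDatum bottomDatum_mem_Icc
  have hUb : ∀ s, |U s| ≤ 1 := abs_tildeAvg_tildeAvg_le hu hb
  have hV'b : ∀ s, |V' s| ≤ 1 := abs_tildeAvg_shift_sub_le antitone_bottomDatum bottomDatum_mem_Icc
  have hU'b : ∀ s, |U' s| ≤ 1 := abs_tildeAvg_shift_sub_le hu hb
  have hVc : Continuous V := continuous_iff_continuousAt.2 fun s ↦ (hV s).continuousAt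
  have hUc : Continuous U := continuous_iff_continuousAt.2 fun s ↦ (hU s).continuousAt
  -- the solution and its derivative functions
  set g : ℝ → ℝ → ℝ := fun θ t ↦ renewalST κ V U θ t with hg
  set gθ : ℝ → ℝ → ℝ := fun θ t ↦ deriv (fun x ↦ g x t) θ with hgθ
  set gθθ : ℝ → ℝ → ℝ := fun θ t ↦ deriv (deriv fun x ↦ g x t) θ with hgθθ
  set gt : ℝ → ℝ → ℝ := fun θ t ↦ botST κ V' θ t + topST κ U' θ t with hgt
  have hcont : ContinuousOn (fun p : ℝ × ℝ ↦ g p.1 p.2) (Icc 0 (2 * Real.pi) ×ˢ Ici 0) :=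
    (continuousOn_renewalST_prod hκ hV hU hVb hV'b hUb hU'b).mono (prod_mono le_rfl (subset_univ _))
  have hderθ : ∀ θ ∈ Ioo 0 (2 * Real.pi), ∀ t ∈ Ioi (0 : ℝ), HasDerivAt (fun x ↦ g x t) (gθ θ t) θ :=
    fun θ hθ t _ ↦ hasDerivAt_renewalST_space hκ hV hV'c hU hU'c hVb hV'b hUb hU'b t hθ
  have hderθθ : ∀ θ ∈ Ioo 0 (2 * Real.pi), ∀ t ∈ Ioi (0 : ℝ), HasDerivAt (fun x ↦ gθ x t) (gθθ θ t) θ :=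
    fun θ hθ t _ ↦ hasDerivAt_deriv_renewalST_space hκ hV hV'c hU hU'c hVb hV'b hUb hU'b t hθ
  have hdert : ∀ θ ∈ Ioo 0 (2 * Real.pi), ∀ t ∈ Ioi (0 : ℝ), HasDerivAt (fun s ↦ g θ s) (gt θ t) t :=
    fun θ hθ t _ ↦ hasDerivAt_renewalST_time hV hV'c hU hU'c hVb hV'b hUb hU'b hθ t
  have hpde : ∀ θ ∈ Ioo 0 (2 * Real.pi), ∀ t ∈ Ioi (0 : ℝ), lswOp κ θ (gθθ θ t) (gθ θ t) (gt θ t) = 0 :=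
    fun θ hθ t _ ↦ lswOp_renewalST hκ hV hV'c hU hU'c hVb hV'b hUb hU'b t hθ
  have hdir : ∀ t, 0 < t → g 0 t = 0 := fun t ht ↦ by
    simp only [hg, renewalST_zero]; exact dataV_eq_zero ht.le
  have hbd : ∀ θ ∈ Icc 0 (2 * Real.pi), ∀ t, 0 ≤ t → g θ t ∈ Icc (0 : ℝ) 1 := fun θ _ t _ ↦
    renewalST_mem_Icc hκ hVc.measurable hUc.measurable
      (tildeAvg_tildeAvg_mem_Icc antitone_bottomDatum bottomDatum_mem_Icc) (tildeAvg_tildeAvg_mem_Icc hu hb) θ t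
  -- lower bounds on the three segments
  set p₁ := preWienerMeasure.real (sleExitsTop κ 1) with hp₁
  have hp₁0 : 0 < p₁ := measureReal_sleExitsTop_one_pos hκ
  haveI := isProbabilityMeasure_preWienerMeasure'
  have hp₁1 : p₁ ≤ 1 := measureReal_le_one
  have hm1 : 0 < m₀ * p₁ := mul_pos hm₀ hp₁0
  have hlow : ∀ θ t, 1 ≤ θ → θ < 2 * Real.pi → t ≤ 1 → m₀ * p₁ ≤ g θ t := fun θ t h1 h2 ht ↦
    (mul_le_mul_of_nonneg_right hm hp₁0.le).trans (renewalST_lower hκ hu hb h1 h2 ht)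
  have hg₁ : ∀ t ∈ Icc (0 : ℝ) 1, m₀ * p₁ ≤ g Real.pi t := fun t ht ↦
    hlow _ _ (by linarith) (by linarith [Real.pi_pos]) ht.2
  have hg₂ : ∀ θ ∈ Icc (1 : ℝ) Real.pi, m₀ * p₁ ≤ g θ 0 := fun θ hθ ↦
    hlow _ _ hθ.1 (by linarith [hθ.2, Real.pi_pos]) zero_le_one
  have hg₃ : ∀ θ ∈ Icc Real.pi (2 * Real.pi), m₀ * p₁ ≤ g θ 1 := by
    intro θ hθ
    rcases eq_or_lt_of_le hθ.2 with h | h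
    · rw [h]
      simp only [hg, renewalST_two_pi]
      calc m₀ * p₁ ≤ m₀ * 1 := mul_le_mul_of_nonneg_left hp₁1 hm₀.le
        _ ≤ u 3 := by rw [mul_one]; exact hm
        _ = u (1 + 2) := by norm_num
        _ ≤ dataU u 1 := le_tildeAvg_tildeAvg hu 1
    · exact hlow _ _ (by linarith [hθ.1]) h le_rfl
  -- the comparison
  have hcomp := LawlerSchrammWerner2002_comparison_explicit (κ := (κ : ℝ)) (g := g) (gθ := gθ) (gθθ := gθθ)
    (gt := gt) hκ' hcont hderθ hderθθ hdert hpde hdir hneu hbd hm1 hm1 hm1 hg₁ hg₂ hg₃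
  have h2π : (2 * Real.pi) ∈ Icc 0 (2 * Real.pi) := ⟨by linarith [Real.pi_pos], le_rfl⟩
  have hH : ∀ t, lswH κ (2 * Real.pi) t = Real.exp (-(lswLambda κ * t)) := fun t ↦ by
    rw [lswH, show 2 * Real.pi / 4 = Real.pi / 2 by ring, Real.sin_pi_div_two, Real.one_rpow, one_mul]
  have hg2π : ∀ t, g (2 * Real.pi) t = U t := fun t ↦ by simp only [hg, renewalST_two_pi]
  constructor
  · intro t ht
    have h := (hcomp t ht (2 * Real.pi) h2π).1
    rw [hH, hg2π] at h
    exact h.trans (tildeAvg_tildeAvg_le hu t)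
  · intro t ht
    have h := (hcomp (t - 2) (by linarith) (2 * Real.pi) h2π).2
    rw [hH, hg2π] at h
    have hsand : u t ≤ U (t - 2) := by
      have := le_tildeAvg_tildeAvg hu (t - 2)
      rwa [show t - 2 + 2 = t by ring] at this
    exact hsand.trans h

end TheoremA

/-! ### Theorem B: the one-arm exponent from Neumann-flat renewal at subsequential limits -/

open Literature.Probability.LatticeModels TopologicalSpace in
/-- **Measure bounds from exponential bounds** (the tree's `IsHittingPDEData.measure_bounds`
with the exponential bounds as hypotheses): if `w(t) = ν{𝔯(K) ≤ e^{-t}}` satisfies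
`c e^{-5t/48} ≤ w(t)` for `t ≥ 1` and `w(t) ≤ c' e^{-5t/48}` for `t ≥ 3`, then
`C⁻¹ r^{5/48} ≤ ν{dist(0,K) < r}` and `ν{dist(0,K) ≤ r} ≤ C r^{5/48}` for `r ∈ (0, 1/2)` with `C`
depending on `c, c'` and the Koebe constant only. [cite: LawlerSchrammWernerEJP2002, Thm. 1.2 and its proof (pp. 2, 8)] -/
theorem measure_bounds_of_exp_bounds {κ₀ : ℝ} (hKoebe : Literature.Analysis.Complex.KoebeCovering κ₀) (hκ₀ : 0 < κ₀)
    {c c' : ℝ} (hc : 0 < c) (hc' : 0 < c') :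
    ∃ C : ℝ, 0 < C ∧ ∀ ν : ProbabilityMeasure (NonemptyCompacts ℂ),
      (∀ t, 1 ≤ t → c * Real.exp (-(5 / 48 * t)) ≤ (ν : Measure (NonemptyCompacts ℂ)).real
        {K | Literature.Analysis.Complex.conformalRadius (K : Set ℂ) ≤ Real.exp (-t)}) →
      (∀ t, 3 ≤ t → (ν : Measure (NonemptyCompacts ℂ)).real
        {K | Literature.Analysis.Complex.conformalRadius (K : Set ℂ) ≤ Real.exp (-t)} ≤ c' * Real.exp (-(5 / 48 * t))) →
      ∀ r : ℝ, 0 < r → r < 1 / 2 →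
        C⁻¹ * r ^ (5 / 48 : ℝ) ≤ (ν : Measure (NonemptyCompacts ℂ)).real (meetsBall r) ∧
          (ν : Measure (NonemptyCompacts ℂ)).real (meetsClosedBall r) ≤ C * r ^ (5 / 48 : ℝ) := by
  have hA : 0 < κ₀⁻¹ := inv_pos.2 hκ₀
  set A : ℝ := κ₀⁻¹ with hA_def
  set a : ℝ := 5 / 48 with ha
  set Cup : ℝ := max (c' * A ^ a) ((A * Real.exp 3) ^ a) with hCup
  set Clow : ℝ := c * Real.exp (-a) with hClow
  have hClow0 : 0 < Clow := by positivity
  have hCup0 : 0 < Cup := lt_max_of_lt_left (by positivity)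
  set C : ℝ := max Cup Clow⁻¹ with hC
  have hC0 : 0 < C := lt_max_of_lt_left hCup0
  refine ⟨C, hC0, fun ν hlow hup r hr0 hr12 => ⟨?_, ?_⟩⟩
  · -- lower bound
    have hr1 : r < 1 := by linarith
    set t : ℝ := 1 - Real.log r with ht_def
    have ht1 : 1 ≤ t := by have := Real.log_neg hr0 hr1; linarith
    have hexp : Real.exp (-t) = Real.exp (-1) * r := by
      rw [ht_def, show -(1 - Real.log r) = -1 + Real.log r by ring, Real.exp_add, Real.exp_log hr0]
    have hsub : {K : NonemptyCompacts ℂ | Literature.Analysis.Complex.conformalRadius (K : Set ℂ) ≤ Real.exp (-t)} ⊆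
        meetsBall r := by
      have : Real.exp (-1) < 1 := Real.exp_lt_one_iff.2 (by norm_num)
      refine setOf_conformalRadius_le_subset_meetsBall ?_ ?_ <;> rw [hexp] <;> nlinarith
    have hmono := measureReal_mono (μ := (ν : Measure (NonemptyCompacts ℂ))) hsub (measure_ne_top _ _)
    have hlow' := hlow t ht1
    have hrpow : Real.exp (-(5 / 48 * t)) = Real.exp (-a) * r ^ a := by
      rw [ht_def, ha, Real.rpow_def_of_pos hr0, ← Real.exp_add]
      ring_nf
    rw [hrpow] at hlow'
    calc C⁻¹ * r ^ a ≤ Clow * r ^ a := by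
          apply mul_le_mul_of_nonneg_right _ (Real.rpow_nonneg hr0.le _)
          rw [inv_le_comm₀ hC0 hClow0]
          exact le_max_right _ _
      _ = c * (Real.exp (-a) * r ^ a) := by rw [hClow]; ring
      _ ≤ _ := hlow'
      _ ≤ _ := hmono
  · -- upper bound
    have hsub := meetsClosedBall_subset_setOf_conformalRadius_le hKoebe hκ₀ r
    have h4r : 0 < A * r := mul_pos hA hr0
    set t : ℝ := -Real.log (A * r) with ht_def
    have hexp : Real.exp (-t) = A * r := by rw [ht_def, neg_neg, Real.exp_log h4r]
    rw [← hexp] at hsub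
    have hmono := measureReal_mono (μ := (ν : Measure (NonemptyCompacts ℂ))) hsub (measure_ne_top _ _)
    have hra : 0 ≤ r ^ a := Real.rpow_nonneg hr0.le _
    have hCup_le : Cup ≤ C := le_max_left _ _
    rcases le_or_gt 3 t with ht2 | ht2
    · have hup' := hup t ht2
      have hrpow : Real.exp (-(5 / 48 * t)) = A ^ a * r ^ a := by
        rw [ht_def, ha, ← Real.mul_rpow hA.le hr0.le, Real.rpow_def_of_pos h4r]
        ring_nf
      rw [hrpow] at hup'
      calc (ν : Measure (NonemptyCompacts ℂ)).real (meetsClosedBall r) ≤ _ := hmono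
        _ ≤ c' * (A ^ a * r ^ a) := hup'
        _ = (c' * A ^ a) * r ^ a := by ring
        _ ≤ Cup * r ^ a := mul_le_mul_of_nonneg_right (le_max_left _ _) hra
        _ ≤ C * r ^ a := mul_le_mul_of_nonneg_right hCup_le hra
    · -- `t < 3`: trivial bound
      have hbig : 1 < A * Real.exp 3 * r := by
        have : Real.exp (-3) < A * r := by
          rw [← hexp]; exact Real.exp_lt_exp.2 (by linarith)
        have e : Real.exp (-3) * Real.exp 3 = 1 := by rw [← Real.exp_add]; simp
        nlinarith [Real.exp_pos 3]
      have hone : 1 ≤ (A * Real.exp 3) ^ a * r ^ a := by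
        rw [← Real.mul_rpow (by positivity) hr0.le]
        exact Real.one_le_rpow hbig.le (by norm_num [ha])
      calc (ν : Measure (NonemptyCompacts ℂ)).real (meetsClosedBall r) ≤ 1 := measureReal_le_one
        _ ≤ (A * Real.exp 3) ^ a * r ^ a := hone
        _ ≤ Cup * r ^ a := mul_le_mul_of_nonneg_right (le_max_right _ _) hra
        _ ≤ C * r ^ a := mul_le_mul_of_nonneg_right hCup_le hra

open Literature.Probability.LatticeModels TopologicalSpace in
/-- **THEOREM B: the one-arm exponent from Neumann-flat renewal at subsequential limits.** Suppose
that for every weak limit `ν` of `lswLaw` along `R_k → ∞` the function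
`w_ν(t) = ν{𝔯(K) ≤ e^{-t}}` (LSW's `h(2π, t)`, (2.2)) is bounded below at `t = 3` by a common
`m₀ > 0` and its renewal extension `renewalST 6 V (avg(avg w_ν))` is Neumann-flat at `2π`
(LSW's reflection condition, the part of Lemma 2.2 not derived here). Then `oneArm_exponent`
holds: `w_ν` is automatically antitone with values in `[0, 1]`, THEOREM A gives the two-sided
exponential bounds with constants uniform in `ν`, Koebe covering turns them into
`C⁻¹ r^{5/48} ≤ ν{dist(0,K) < r}`, `ν{dist(0,K) ≤ r} ≤ C r^{5/48}`, and LSW §3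
(`crossingBounds_of_subseqLimits`, `oneArm_exponent_of_crossingBounds`, RSW circuits) concludes.
[cite: LawlerSchrammWernerEJP2002, Thm. 1.1, Thm. 1.2, §2–§3] -/
theorem oneArm_exponent_of_neumannRenewal {m₀ : ℝ} (hm₀ : 0 < m₀)
    (hyp : ∀ (R : ℕ → ℝ) (ν : ProbabilityMeasure (NonemptyCompacts ℂ)),
      Tendsto R atTop atTop → Tendsto (lswLaw ∘ R) atTop (𝓝 ν) →
        m₀ ≤ (ν : Measure (NonemptyCompacts ℂ)).real
          {K | Literature.Analysis.Complex.conformalRadius (K : Set ℂ) ≤ Real.exp (-3)} ∧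
        ∀ t, 0 < t → HasDerivWithinAt (fun x ↦ renewalST 6 dataV
          (dataU fun s ↦ (ν : Measure (NonemptyCompacts ℂ)).real
            {K | Literature.Analysis.Complex.conformalRadius (K : Set ℂ) ≤ Real.exp (-s)}) x t)
          0 (Iic (2 * Real.pi)) (2 * Real.pi)) :
    oneArm_exponent := by
  have h6 : (4 : ℝ≥0) < 6 := by norm_num
  have hlam : lswLambda ((6 : ℝ≥0) : ℝ) = 5 / 48 := by rw [show ((6 : ℝ≥0) : ℝ) = 6 by norm_num]; exact lswLambda_six
  -- `w_ν` is antitone with values in `[0, 1]`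
  have hw : ∀ ν : ProbabilityMeasure (NonemptyCompacts ℂ),
      Antitone (fun s ↦ (ν : Measure (NonemptyCompacts ℂ)).real
        {K | Literature.Analysis.Complex.conformalRadius (K : Set ℂ) ≤ Real.exp (-s)}) ∧
      ∀ s, (ν : Measure (NonemptyCompacts ℂ)).real
        {K | Literature.Analysis.Complex.conformalRadius (K : Set ℂ) ≤ Real.exp (-s)} ∈ Icc (0 : ℝ) 1 := by
    intro ν
    refine ⟨fun a b hab ↦ measureReal_mono (fun K hK ↦ ?_) (measure_ne_top _ _),
      fun s ↦ ⟨measureReal_nonneg, measureReal_le_one⟩⟩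
    have hK' : Literature.Analysis.Complex.conformalRadius (K : Set ℂ) ≤ Real.exp (-b) := hK
    show Literature.Analysis.Complex.conformalRadius (K : Set ℂ) ≤ Real.exp (-a)
    exact hK'.trans (Real.exp_le_exp.2 (by linarith))
  have hπ := Real.pi_gt_three
  have hp₁0 : 0 < preWienerMeasure.real (sleExitsTop 6 1) := measureReal_sleExitsTop_one_pos h6
  have hmp : 0 < m₀ * preWienerMeasure.real (sleExitsTop 6 1) := mul_pos hm₀ hp₁0
  have hc₂0 : 0 < (1 + Real.pi ^ 2) / (m₀ * preWienerMeasure.real (sleExitsTop 6 1)) +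
      Real.pi ^ 2 / (m₀ * preWienerMeasure.real (sleExitsTop 6 1)) +
      1 / (m₀ * preWienerMeasure.real (sleExitsTop 6 1)) := by positivity
  have hA0 : 0 < Real.sin (Real.pi / 4) ^ lswQ ((6 : ℝ≥0) : ℝ) * Real.exp (-(5 / 48 * 1)) :=
    mul_pos (Real.rpow_pos_of_pos (sin_quarter_pos Real.pi_pos (by linarith)) _) (Real.exp_pos _)
  have hB0 : 0 < Real.sin (1 / 4) ^ lswQ ((6 : ℝ≥0) : ℝ) * Real.exp (-(5 / 48 * 0)) :=
    mul_pos (Real.rpow_pos_of_pos (sin_quarter_pos one_pos (by linarith)) _) (Real.exp_pos _)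
  have hc₁0 : 0 < ((1 + Real.pi ^ 2) / (Real.sin (Real.pi / 4) ^ lswQ ((6 : ℝ≥0) : ℝ) * Real.exp (-(5 / 48 * 1))) +
      Real.pi ^ 2 / (Real.sin (1 / 4) ^ lswQ ((6 : ℝ≥0) : ℝ) * Real.exp (-(5 / 48 * 0)))) *
      Real.exp (2 * (5 / 48)) :=
    mul_pos (add_pos (div_pos (by positivity) hA0) (div_pos (by positivity) hB0)) (Real.exp_pos _)
  -- exponential bounds at every subsequential limit
  have hexp : ∀ (R : ℕ → ℝ) (ν : ProbabilityMeasure (NonemptyCompacts ℂ)),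
      Tendsto R atTop atTop → Tendsto (lswLaw ∘ R) atTop (𝓝 ν) →
      (∀ t, 1 ≤ t → ((1 + Real.pi ^ 2) / (m₀ * preWienerMeasure.real (sleExitsTop 6 1)) +
          Real.pi ^ 2 / (m₀ * preWienerMeasure.real (sleExitsTop 6 1)) +
          1 / (m₀ * preWienerMeasure.real (sleExitsTop 6 1)))⁻¹ * Real.exp (-(5 / 48 * t)) ≤
        (ν : Measure (NonemptyCompacts ℂ)).real
          {K | Literature.Analysis.Complex.conformalRadius (K : Set ℂ) ≤ Real.exp (-t)}) ∧
      (∀ t, 3 ≤ t → (ν : Measure (NonemptyCompacts ℂ)).real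
        {K | Literature.Analysis.Complex.conformalRadius (K : Set ℂ) ≤ Real.exp (-t)} ≤
          (((1 + Real.pi ^ 2) / (Real.sin (Real.pi / 4) ^ lswQ ((6 : ℝ≥0) : ℝ) * Real.exp (-(5 / 48 * 1))) +
            Real.pi ^ 2 / (Real.sin (1 / 4) ^ lswQ ((6 : ℝ≥0) : ℝ) * Real.exp (-(5 / 48 * 0)))) *
            Real.exp (2 * (5 / 48))) * Real.exp (-(5 / 48 * t))) := by
    intro R ν hR hν
    obtain ⟨hm, hneu⟩ := hyp R ν hR hν
    have hA := LawlerSchrammWerner2002_exp_bounds_of_neumann h6 (hw ν).1 (hw ν).2 hm₀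
      (by simpa using hm) hneu
    rw [hlam] at hA
    refine ⟨fun t ht ↦ ?_, fun t ht ↦ ?_⟩
    · rw [inv_mul_eq_div]
      exact hA.1 t ht
    · refine (hA.2 t ht).trans (le_of_eq ?_)
      rw [show -(5 / 48 * (t - 2)) = 2 * (5 / 48) + -(5 / 48 * t) by ring, Real.exp_add]
      ring
  obtain ⟨C, hC, hb⟩ := measure_bounds_of_exp_bounds koebeCovering_const (by positivity)
    (inv_pos.2 hc₂0) hc₁0
  have hlim : ∀ (R : ℕ → ℝ) (ν : ProbabilityMeasure (NonemptyCompacts ℂ)),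
      Tendsto R atTop atTop → Tendsto (lswLaw ∘ R) atTop (𝓝 ν) →
        ∀ r : ℝ, 0 < r → r < 1 / 2 →
          C⁻¹ * r ^ (5 / 48 : ℝ) ≤ (ν : Measure (NonemptyCompacts ℂ)).real (meetsBall r) ∧
            (ν : Measure (NonemptyCompacts ℂ)).real (meetsClosedBall r) ≤ C * r ^ (5 / 48 : ℝ) :=
    fun R ν hR hν ↦ hb ν (hexp R ν hR hν).1 (hexp R ν hR hν).2
  have hCinv2 : 0 < C⁻¹ / 2 := by positivity
  refine oneArm_exponent_of_crossingBounds ⟨fun r => C⁻¹ / 2 * r ^ (5 / 48 : ℝ),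
    tendsto_log_const_mul_rpow_div_log hCinv2, fun r hr0 hr2 => ⟨by positivity, ?_⟩⟩
    ⟨fun r => 2 * C * r ^ (5 / 48 : ℝ), tendsto_log_const_mul_rpow_div_log (by positivity),
    fun r hr0 hr2 => ?_⟩ BollobasRiordan2006_openCircuit_holds
  · obtain ⟨s₀, hs₀⟩ := crossingBounds_of_subseqLimits hC hlim hr0 hr2
    refine ⟨s₀, fun R hR => ?_⟩
    have h1 := (hs₀ R hR).1
    have e : C⁻¹ / 2 * r ^ (5 / 48 : ℝ) = C⁻¹ * r ^ (5 / 48 : ℝ) / 2 := by ring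
    show C⁻¹ / 2 * r ^ (5 / 48 : ℝ) ≤ _
    rwa [e]
  · obtain ⟨s₀, hs₀⟩ := crossingBounds_of_subseqLimits hC hlim hr0 hr2
    refine ⟨s₀, fun R hR => ?_⟩
    have h2 := (hs₀ R hR).2
    show _ ≤ 2 * C * r ^ (5 / 48 : ℝ)
    rwa [mul_assoc]

end Literature.Probability.Percolation
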